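import Mathlib
import Summits.KontsevichZagierPeriods.Zeta5Search.Families.CellularIntegral
import HarnessLib

/-!
# ζ(5) search — Families: gap coordinates on the open simplex (measure-preserving parametrisations)

HONEST FRAMING: systematic search; no irrationality claim unless certified.  This file contains NO statement about
zeta values.  It is file 2 of 4 of the ANALYTIC half of Brown's convergence criterion [Brown2016, §2.4, Lemma 3.6,
Def. 5.1] for the generalised cellular integrals of `Families/CellularIntegral.lean` (seat P2).

The open simplex `0 = z₁ < t₁ < ⋯ < t_ℓ < 1 = z_{n−1}` (`openSimplex ℓ`, marked points `pt t k`, `k = 0,…,ℓ+1`) is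
parametrised by its GAPS `g_w = pt t (w+1) − pt t w`, `w = 0,…,ℓ` (`gapN`), which are positive and sum to `1`:
* `pt_sub_pt_eq_sum_gapN` : `pt t v − pt t u = Σ_{u ≤ w < v} g_w`;
* `cumsum h` (`t_i = Σ_{j ≤ i} h_j`) is a VOLUME-PRESERVING linear map of `ℝ^ℓ` (unitriangular matrix, `det = 1`,
  `Real.map_matrix_volume_pi_eq_smul_volume_pi`) carrying the gap region `gapSet ℓ = {h > 0, Σ h < 1}` onto the
  simplex, with gaps `(h₀,…,h_{ℓ−1}, 1 − Σ h)`; hence `lintegral_openSimplex_eq_gapSet`: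
  `∫_{openSimplex} F = ∫_{gapSet} F ∘ cumsum` for measurable `F ≥ 0`;
* `lintegral_gapSet_extGap_eq` : for measurable `Φ ≥ 0` on full gap vectors, `∫_{h ∈ gapSet} Φ(extGap w⋆ h)` does not
  depend on the slot `w⋆` at which the dependent gap `1 − Σ h` is inserted (`extGap w⋆ h = Fin.insertNth w⋆ (1 − Σh) h`)
  — proved WITHOUT determinants: peel the coordinate `a` (`w⋆ = castSucc a`) by Tonelli along
  `MeasurableEquiv.piFinSuccAbove`, reflect it (`x ↦ (1 − Σh') − x`, `lintegral_sub_left_eq_self`), and un-peel at the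
  last slot.  Consequence `lintegral_openSimplex_eq_gapSet_extGap`: the simplex integral may be computed in the `ℓ`
  gaps complementary to ANY chosen gap `w⋆` — the device that lets the sequel drop the LARGEST gap of a Hepp sector.
Standard axioms only.
-/

noncomputable section

open MeasureTheory Set ENNReal

namespace Summit.KontsevichZagierPeriods.Zeta5Search.Families.Cellular

variable {ℓ : ℕ}

/-! ### Gaps -/

/-- The `w`-th gap `pt t (w+1) − pt t w` of the marked points (`w = 0,…,ℓ`; zero for `w ≥ ℓ+1`). -/
def gapN (t : Fin ℓ → ℝ) (w : ℕ) : ℝ := pt t (w + 1) - pt t w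

/-- `pt t 0 = 0`. -/
@[simp] theorem pt_zero (t : Fin ℓ → ℝ) : pt t 0 = 0 := by simp [pt]

/-- `pt t k = 1` for `k ≥ ℓ + 1`. -/
theorem pt_of_gt (t : Fin ℓ → ℝ) {k : ℕ} (hk : ℓ + 1 ≤ k) : pt t k = 1 := by
  unfold pt
  rw [if_neg (by omega), dif_neg (by omega)]

/-- `pt t k = t ⟨k − 1, _⟩` for `1 ≤ k ≤ ℓ`. -/
theorem pt_of_pos (t : Fin ℓ → ℝ) {k : ℕ} (hk : 0 < k) (hk' : k ≤ ℓ) :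
    pt t k = t ⟨k - 1, by omega⟩ := by
  unfold pt
  rw [if_neg (by omega), dif_pos (by omega)]

/-- Differences of marked points are sums of consecutive gaps. -/
theorem pt_sub_pt_eq_sum_gapN (t : Fin ℓ → ℝ) {u v : ℕ} (huv : u ≤ v) :
    pt t v - pt t u = ∑ w ∈ Finset.Ico u v, gapN t w := by
  unfold gapN
  rw [Finset.sum_Ico_eq_sub _ huv, Finset.sum_range_sub, Finset.sum_range_sub]
  ring

/-- The gaps sum to `1`. -/
theorem sum_gapN (t : Fin ℓ → ℝ) : ∑ w ∈ Finset.range (ℓ + 1), gapN t w = 1 := by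
  rw [Finset.range_eq_Ico, ← pt_sub_pt_eq_sum_gapN t (Nat.zero_le _), pt_zero, pt_of_gt t le_rfl]
  ring

/-- Membership in the open simplex = positivity of all gaps. -/
theorem mem_openSimplex_iff_gapN (t : Fin ℓ → ℝ) : t ∈ openSimplex ℓ ↔ ∀ w : Fin (ℓ + 1), 0 < gapN t w := by
  simp [openSimplex, gapN, sub_pos]

/-! ### Cumulative sums: a volume-preserving parametrisation by the first `ℓ` gaps -/

/-- `cumsum h i = Σ_{j ≤ i} h_j`. -/
def cumsum (h : Fin ℓ → ℝ) : Fin ℓ → ℝ := fun i => ∑ j, if j ≤ i then h j else 0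

/-- The unitriangular matrix of `cumsum`. -/
def cumsumMatrix (ℓ : ℕ) : Matrix (Fin ℓ) (Fin ℓ) ℝ := Matrix.of fun i j => if j ≤ i then 1 else 0

/-- `cumsum` is the linear map of `cumsumMatrix`. -/
theorem toLin'_cumsumMatrix : ⇑(Matrix.toLin' (cumsumMatrix ℓ)) = cumsum := by
  ext h i
  simp [Matrix.toLin'_apply, Matrix.mulVec, dotProduct, cumsumMatrix, cumsum, ite_mul]

/-- `det cumsumMatrix = 1` (lower unitriangular). -/
theorem det_cumsumMatrix : (cumsumMatrix ℓ).det = 1 := by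
  rw [Matrix.det_of_lowerTriangular (cumsumMatrix ℓ)]
  · simp [cumsumMatrix]
  · intro i j hij
    have hij' : i < j := by simpa using hij
    simp [cumsumMatrix, not_le.2 hij']

/-- `cumsum` is measurable. -/
theorem measurable_cumsum : Measurable (cumsum (ℓ := ℓ)) := by
  rw [← toLin'_cumsumMatrix]
  exact (LinearMap.continuous_on_pi _).measurable

/-- `cumsum` preserves Lebesgue measure on `ℝ^ℓ`. -/
theorem measurePreserving_cumsum : MeasurePreserving (cumsum (ℓ := ℓ)) volume volume := by
  have hdet : (cumsumMatrix ℓ).det ≠ 0 := by rw [det_cumsumMatrix]; exact one_ne_zero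
  have h := Real.map_matrix_volume_pi_eq_smul_volume_pi hdet
  rw [det_cumsumMatrix, inv_one, abs_one, ENNReal.ofReal_one, one_smul, toLin'_cumsumMatrix] at h
  exact ⟨measurable_cumsum, h⟩

/-- Marked points of `cumsum h`: `pt (cumsum h) k = Σ_{j < k} h_j` for `k ≤ ℓ`. -/
theorem pt_cumsum (h : Fin ℓ → ℝ) {k : ℕ} (hk : k ≤ ℓ) :
    pt (cumsum h) k = ∑ j : Fin ℓ, if (j : ℕ) < k then h j else 0 := by
  rcases Nat.eq_zero_or_pos k with rfl | hpos
  · simp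
  · rw [pt_of_pos _ hpos hk]
    unfold cumsum
    refine Finset.sum_congr rfl fun j _ => ?_
    have : j ≤ (⟨k - 1, by omega⟩ : Fin ℓ) ↔ (j : ℕ) < k := by
      rw [Fin.le_def]; simp only; omega
    simp [this]

/-- The first `ℓ` gaps of `cumsum h` are the coordinates of `h`. -/
theorem gapN_cumsum_lt (h : Fin ℓ → ℝ) (w : Fin ℓ) : gapN (cumsum h) w = h w := by
  unfold gapN
  rw [pt_cumsum h (Nat.succ_le_of_lt w.isLt), pt_cumsum h w.isLt.le, ← Finset.sum_sub_distrib]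
  rw [Finset.sum_eq_single w]
  · simp
  · intro j _ hj
    have hj' : (j : ℕ) ≠ w := fun e => hj (Fin.ext e)
    by_cases h1 : (j : ℕ) < w
    · simp [h1, show (j : ℕ) < w + 1 by omega]
    · simp [h1, show ¬ (j : ℕ) < w + 1 by omega]
  · simp

/-- The last gap of `cumsum h` is `1 − Σ h`. -/
theorem gapN_cumsum_last (h : Fin ℓ → ℝ) : gapN (cumsum h) ℓ = 1 - ∑ j, h j := by
  unfold gapN
  rw [pt_of_gt _ le_rfl, pt_cumsum h le_rfl]
  congr 1
  exact Finset.sum_congr rfl fun j _ => by simp [j.isLt]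

/-- The gap region `{h > 0, Σ h < 1}`. -/
def gapSet (ℓ : ℕ) : Set (Fin ℓ → ℝ) := {h | (∀ j, 0 < h j) ∧ ∑ j, h j < 1}

/-- The gap region is measurable. -/
theorem measurableSet_gapSet (ℓ : ℕ) : MeasurableSet (gapSet ℓ) := by
  have h1 : MeasurableSet {h : Fin ℓ → ℝ | ∀ j, 0 < h j} := by
    have : {h : Fin ℓ → ℝ | ∀ j, 0 < h j} = ⋂ j, {h | 0 < h j} := by ext; simp
    rw [this]; exact MeasurableSet.iInter fun j => measurableSet_lt measurable_const (measurable_pi_apply j)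
  have h2 : MeasurableSet {h : Fin ℓ → ℝ | ∑ j, h j < 1} :=
    measurableSet_lt (Finset.measurable_sum _ fun j _ => measurable_pi_apply j) measurable_const
  have : gapSet ℓ = {h | ∀ j, 0 < h j} ∩ {h | ∑ j, h j < 1} := by ext; simp [gapSet]
  rw [this]; exact h1.inter h2

/-- `cumsum` pulls the open simplex back to the gap region. -/
theorem preimage_cumsum_openSimplex : cumsum ⁻¹' openSimplex ℓ = gapSet ℓ := by
  ext h
  simp only [mem_preimage, mem_openSimplex_iff_gapN, gapSet, mem_setOf_eq]
  constructor
  · intro H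
    refine ⟨fun j => ?_, ?_⟩
    · have := H (Fin.castSucc j)
      rwa [Fin.val_castSucc, gapN_cumsum_lt] at this
    · have := H (Fin.last ℓ)
      rw [Fin.val_last, gapN_cumsum_last] at this
      linarith
  · rintro ⟨hpos, hsum⟩ w
    rcases Fin.eq_castSucc_or_eq_last w with ⟨j, rfl⟩ | rfl
    · rw [Fin.val_castSucc, gapN_cumsum_lt]; exact hpos j
    · rw [Fin.val_last, gapN_cumsum_last]; linarith

/-- **Gap coordinates**: `∫_{openSimplex} F = ∫_{gapSet} F ∘ cumsum` for measurable `F ≥ 0`. -/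
theorem lintegral_openSimplex_eq_gapSet (F : (Fin ℓ → ℝ) → ℝ≥0∞) (hF : Measurable F) :
    ∫⁻ t in openSimplex ℓ, F t = ∫⁻ h in gapSet ℓ, F (cumsum h) := by
  rw [← measurePreserving_cumsum.setLIntegral_comp_preimage (measurableSet_openSimplex ℓ) hF,
    preimage_cumsum_openSimplex]

/-! ### Inserting the dependent gap at an arbitrary slot -/

/-- The full gap vector with free gaps `h` and the dependent gap `1 − Σ h` inserted at slot `wstar`. -/
def extGap (wstar : Fin (ℓ + 1)) (h : Fin ℓ → ℝ) : Fin (ℓ + 1) → ℝ := Fin.insertNth wstar (1 - ∑ j, h j) h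

/-- `extGap wstar` is measurable. -/
theorem measurable_extGap (wstar : Fin (ℓ + 1)) : Measurable (extGap (ℓ := ℓ) wstar) := by
  have : extGap (ℓ := ℓ) wstar = fun h =>
      (MeasurableEquiv.piFinSuccAbove (fun _ : Fin (ℓ + 1) => ℝ) wstar).symm (1 - ∑ j, h j, h) := by
    ext h i
    rw [MeasurableEquiv.piFinSuccAbove_symm_apply, Fin.insertNthEquiv, Equiv.coe_fn_mk]
    rfl
  rw [this]
  exact (MeasurableEquiv.measurable _).comp
    ((measurable_const.sub (Finset.measurable_sum _ fun j _ => measurable_pi_apply j)).prodMk measurable_id)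

/-- The gaps of `cumsum h` form the vector `extGap (Fin.last ℓ) h`. -/
theorem gapN_cumsum_eq_extGap_last (h : Fin ℓ → ℝ) (w : Fin (ℓ + 1)) :
    gapN (cumsum h) w = extGap (Fin.last ℓ) h w := by
  unfold extGap
  rw [Fin.insertNth_last']
  rcases Fin.eq_castSucc_or_eq_last w with ⟨j, rfl⟩ | rfl
  · rw [Fin.val_castSucc, gapN_cumsum_lt, Fin.snoc_castSucc]
  · rw [Fin.val_last, gapN_cumsum_last, Fin.snoc_last]

section Swap

variable {m : ℕ}

/-- Tuple identity behind the swap: `snoc (insertNth a y h') x = insertNth (castSucc a) y (snoc h' x)`. -/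
theorem snoc_insertNth_eq (a : Fin (m + 1)) (y x : ℝ) (h' : Fin m → ℝ) :
    (Fin.snoc (Fin.insertNth a y h' : Fin (m + 1) → ℝ) x : Fin (m + 2) → ℝ) =
      Fin.insertNth (Fin.castSucc a) y (Fin.snoc h' x : Fin (m + 1) → ℝ) := by
  ext i
  rcases Fin.eq_castSucc_or_eq_last i with ⟨i', rfl⟩ | rfl
  · rw [Fin.snoc_castSucc]
    by_cases hia : i' = a
    · subst hia
      rw [Fin.insertNth_apply_same, Fin.insertNth_apply_same]
    · obtain ⟨j, rfl⟩ := Fin.exists_succAbove_eq hia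
      rw [Fin.insertNth_apply_succAbove]
      have hcs : Fin.castSucc (a.succAbove j) = (Fin.castSucc a).succAbove (Fin.castSucc j) := by
        unfold Fin.succAbove
        by_cases hj : Fin.castSucc j < a
        · have hj' : Fin.castSucc (Fin.castSucc j) < Fin.castSucc a := by simpa [Fin.lt_def] using hj
          rw [if_pos hj, if_pos hj']
        · have hj' : ¬ Fin.castSucc (Fin.castSucc j) < Fin.castSucc a := by simpa [Fin.lt_def] using hj
          rw [if_neg hj, if_neg hj']
          ext; simp
      rw [hcs, Fin.insertNth_apply_succAbove, Fin.snoc_castSucc]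
  · rw [Fin.snoc_last]
    have hl : Fin.last (m + 1) = (Fin.castSucc a).succAbove (Fin.last m) := by
      rw [Fin.succAbove_of_le_castSucc _ _ (Fin.castSucc_le_castSucc_iff.2 (Fin.le_last a)), Fin.succ_last]
    rw [hl, Fin.insertNth_apply_succAbove, Fin.snoc_last]

/-- Membership of an inserted tuple in the gap region. -/
theorem insertNth_mem_gapSet_iff (a : Fin (m + 1)) (y : ℝ) (h' : Fin m → ℝ) :
    (Fin.insertNth a y h' : Fin (m + 1) → ℝ) ∈ gapSet (m + 1) ↔
      0 < y ∧ (∀ j, 0 < h' j) ∧ y + ∑ j, h' j < 1 := by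
  simp only [gapSet, mem_setOf_eq, Fin.forall_iff_succAbove a, Fin.insertNth_apply_same,
    Fin.insertNth_apply_succAbove, Fin.sum_univ_succAbove _ a, and_assoc]

/-- The swap of the dependent gap from the last slot to slot `castSucc a`. -/
theorem lintegral_gapSet_extGap_castSucc (Φ : (Fin (m + 2) → ℝ) → ℝ≥0∞) (hΦ : Measurable Φ) (a : Fin (m + 1)) :
    ∫⁻ h in gapSet (m + 1), Φ (extGap (Fin.castSucc a) h) = ∫⁻ h in gapSet (m + 1), Φ (extGap (Fin.last (m + 1)) h) := by
  -- the two integrands as functions on all of `ℝ^{m+1}`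
  set IL : (Fin (m + 1) → ℝ) → ℝ≥0∞ := (gapSet (m + 1)).indicator fun h => Φ (extGap (Fin.last (m + 1)) h) with hIL
  set IA : (Fin (m + 1) → ℝ) → ℝ≥0∞ := (gapSet (m + 1)).indicator fun h => Φ (extGap (Fin.castSucc a) h) with hIA
  have hILm : Measurable IL := (hΦ.comp (measurable_extGap _)).indicator (measurableSet_gapSet _)
  have hIAm : Measurable IA := (hΦ.comp (measurable_extGap _)).indicator (measurableSet_gapSet _)
  rw [← lintegral_indicator (measurableSet_gapSet _), ← lintegral_indicator (measurableSet_gapSet _), ← hIL, ← hIA]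
  -- peel coordinate `a` on the left-slot side and the last coordinate on the other side
  have hmpA := (volume_preserving_piFinSuccAbove (fun _ : Fin (m + 1) => ℝ) a).symm
  have hmpL := (volume_preserving_piFinSuccAbove (fun _ : Fin (m + 1) => ℝ) (Fin.last m)).symm
  have heA' : ∀ p : ℝ × (Fin m → ℝ),
      (MeasurableEquiv.piFinSuccAbove (fun _ : Fin (m + 1) => ℝ) a).symm p = Fin.insertNth a p.1 p.2 := fun p => by
    rw [MeasurableEquiv.piFinSuccAbove_symm_apply, Fin.insertNthEquiv, Equiv.coe_fn_mk]
  have heL' : ∀ p : ℝ × (Fin m → ℝ), (MeasurableEquiv.piFinSuccAbove (fun _ : Fin (m + 1) => ℝ) (Fin.last m)).symm p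
      = (Fin.snoc p.2 p.1 : Fin (m + 1) → ℝ) := fun p => by
    rw [MeasurableEquiv.piFinSuccAbove_symm_apply, Fin.insertNthEquiv, Equiv.coe_fn_mk, Fin.insertNth_last']
  rw [← hmpL.lintegral_comp_emb (MeasurableEquiv.measurableEmbedding _) IA,
    ← hmpA.lintegral_comp_emb (MeasurableEquiv.measurableEmbedding _) IL]
  rw [Measure.volume_eq_prod,
    lintegral_prod_symm' (fun p => IA ((MeasurableEquiv.piFinSuccAbove (fun _ : Fin (m + 1) => ℝ) (Fin.last m)).symm p))
      (hIAm.comp (MeasurableEquiv.measurable _)),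
    lintegral_prod_symm' (fun p => IL ((MeasurableEquiv.piFinSuccAbove (fun _ : Fin (m + 1) => ℝ) a).symm p))
      (hILm.comp (MeasurableEquiv.measurable _))]
  refine lintegral_congr fun h' => ?_
  simp_rw [heA', heL']
  -- reflect the peeled coordinate on the last-slot side: x ↦ (1 − Σ h') − x
  have hrefl := lintegral_sub_left_eq_self (μ := (volume : Measure ℝ))
    (fun x => IL (Fin.insertNth a x h')) (1 - ∑ j, h' j)
  beta_reduce at hrefl
  rw [← hrefl]
  refine lintegral_congr fun x => ?_
  -- pointwise identity of the two integrands
  set y : ℝ := 1 - ∑ j, h' j - x with hy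
  simp only [hIL, hIA]
  have hmem : (Fin.insertNth a y h' : Fin (m + 1) → ℝ) ∈ gapSet (m + 1) ↔
      (Fin.snoc h' x : Fin (m + 1) → ℝ) ∈ gapSet (m + 1) := by
    rw [insertNth_mem_gapSet_iff, ← Fin.insertNth_last', insertNth_mem_gapSet_iff, hy]
    constructor
    · rintro ⟨h1, h2, h3⟩; exact ⟨by linarith, h2, by linarith⟩
    · rintro ⟨h1, h2, h3⟩; exact ⟨by linarith, h2, by linarith⟩
  have hsum1 : ∑ j, (Fin.insertNth a y h' : Fin (m + 1) → ℝ) j = y + ∑ j, h' j := by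
    rw [Fin.sum_univ_succAbove _ a, Fin.insertNth_apply_same]
    simp only [Fin.insertNth_apply_succAbove]
  have hsum2 : ∑ j, (Fin.snoc h' x : Fin (m + 1) → ℝ) j = (∑ j, h' j) + x := by
    rw [Fin.sum_univ_castSucc]
    simp only [Fin.snoc_castSucc, Fin.snoc_last]
  have hvec : extGap (Fin.last (m + 1)) (Fin.insertNth a y h' : Fin (m + 1) → ℝ) =
      extGap (Fin.castSucc a) (Fin.snoc h' x : Fin (m + 1) → ℝ) := by
    unfold extGap
    rw [hsum1, hsum2, Fin.insertNth_last']
    have e1 : 1 - (y + ∑ j, h' j) = x := by rw [hy]; ring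
    have e2 : 1 - (∑ j, h' j + x) = y := by rw [hy]; ring
    rw [e1, e2, snoc_insertNth_eq]
  by_cases hs : (Fin.snoc h' x : Fin (m + 1) → ℝ) ∈ gapSet (m + 1)
  · rw [indicator_of_mem hs, indicator_of_mem (hmem.2 hs), hvec]
  · rw [indicator_of_notMem hs, indicator_of_notMem (fun h => hs (hmem.1 h))]

end Swap

/-- **Slot independence**: `∫_{h ∈ gapSet} Φ(extGap w⋆ h)` does not depend on the slot `w⋆` of the dependent gap. -/
theorem lintegral_gapSet_extGap_eq (Φ : (Fin (ℓ + 1) → ℝ) → ℝ≥0∞) (hΦ : Measurable Φ) (wstar : Fin (ℓ + 1)) :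
    ∫⁻ h in gapSet ℓ, Φ (extGap wstar h) = ∫⁻ h in gapSet ℓ, Φ (extGap (Fin.last ℓ) h) := by
  rcases Fin.eq_castSucc_or_eq_last wstar with ⟨a, rfl⟩ | rfl
  · cases ℓ with
    | zero => exact Fin.elim0 a
    | succ m => exact lintegral_gapSet_extGap_castSucc Φ hΦ a
  · rfl

/-- **Gap coordinates with an arbitrary dependent gap**: for measurable `Φ ≥ 0` on gap vectors and any slot `w⋆`,
`∫_{t ∈ openSimplex} Φ(gaps of t) = ∫_{h ∈ gapSet} Φ(extGap w⋆ h)`. -/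
theorem lintegral_openSimplex_eq_gapSet_extGap (Φ : (Fin (ℓ + 1) → ℝ) → ℝ≥0∞) (hΦ : Measurable Φ)
    (wstar : Fin (ℓ + 1)) :
    ∫⁻ t in openSimplex ℓ, Φ (fun w => gapN t w) = ∫⁻ h in gapSet ℓ, Φ (extGap wstar h) := by
  have hmeas : Measurable fun t : Fin ℓ → ℝ => Φ fun w : Fin (ℓ + 1) => gapN t w :=
    hΦ.comp (measurable_pi_iff.2 fun w => ((continuous_pt _).sub (continuous_pt _)).measurable)
  rw [lintegral_openSimplex_eq_gapSet _ hmeas, lintegral_gapSet_extGap_eq Φ hΦ wstar]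
  refine lintegral_congr fun h => ?_
  congr 1
  ext w
  exact gapN_cumsum_eq_extGap_last h w

end Summit.KontsevichZagierPeriods.Zeta5Search.Families.Cellular
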